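import Summits.CriticalPhenomena.PercolationContinuityZ3.Theorems.PercNearOneGluingNoHeavyLowerTailSahiCTCLadderThreeRowThreeSums
import HarnessLib

/-!
# `NoHeavyLowerTail` (crux stmt-CriticalPhenomena-4575), P3 lane: the restriction cube `κ_R` of the row `#dbl = 3` of `(L_3)`

Support file (seat `prim-l12-p3`, gen 26; `--supports stmt-CriticalPhenomena-4575`).  Paper proof `prim-l12-p3/ROW3-PROOF-g26.md` §3 (R).
`κ` is monotone in the free set (`kap_le_kap_of_subset`, iterating `kap_erase_le`); combining the PEEL chain (`kap_peel_le`), its triangle block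
(`le_two_mul_peelSum_of_core`) and monotonicity gives the chain bound `2κ(D₀,K) + L(2#s+1) − L² ≤ 2κ(D₀,s)` for a list of `L` points of `s∖K`
whose links contain a triangle inside the core `K` (`two_mul_kap_core_add_le`); for the row, the `e = 3` points of `T` (those `y` with
`p + y ∈ 𝒳 ∩ 𝒵` for all three pairs `p ⊆ D`) have the triangle `D` in their link (`full_link_triangle`), and the 5-point base `D ∪ {a,b}` with
`D` common and `a, b` full carries 13 explicit common sets plus the common sets `d + a + b` (`thirteen_le_kap_base`), 4 plus those if only `D`
is common (`four_le_kap_base`).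
Nothing is asserted about the crux.
-/

namespace Summit.CriticalPhenomena.PercolationContinuityZ3.Theorems.SahiCTCForms

open Finset MvPolynomial SahiCTCGenFun SahiCTCWeightedLYM

variable {α : Type*} [DecidableEq α] [Fintype α]

section RowThreeChain
variable {𝒳 𝒵 : Finset (Finset α)}

omit [Fintype α] in
/-- **Monotonicity of `κ` in the free set** (iterated `kap_erase_le`). [this work] -/
theorem kap_le_kap_of_subset (h𝒳 : IsUpperSet (𝒳 : Set (Finset α))) (h𝒵 : IsUpperSet (𝒵 : Set (Finset α))) {D : Finset α} :
    ∀ (n : ℕ) (K s : Finset α), #(s \ K) = n → K ⊆ s → Disjoint D s → kap 𝒳 𝒵 D K ≤ kap 𝒳 𝒵 D s := by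
  intro n
  induction n with
  | zero =>
    intro K s h hKs _
    rw [card_eq_zero, sdiff_eq_empty_iff_subset] at h
    rw [subset_antisymm hKs h]
  | succ n ih =>
    intro K s h hKs hDs
    obtain ⟨v, hv⟩ : (s \ K).Nonempty := card_pos.1 (by omega)
    obtain ⟨hvs, hvK⟩ := mem_sdiff.1 hv
    have h1 := kap_erase_le h𝒳 h𝒵 hDs hvs
    have h2 := ih K (s.erase v) (by rw [erase_sdiff_comm, card_erase_of_mem hv, h]; rfl)
      (fun k hk => mem_erase.2 ⟨fun h => hvK (h ▸ hk), hKs hk⟩) (hDs.mono_right (erase_subset v s))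
    exact h2.trans h1

omit [Fintype α] in
/-- **Chain bound**: peel a list of `L` points of `s ∖ K` whose links have `κ ≥ #s' + 1` whenever the core `K` is present; then
`2κ(D₀, K) + L(2#s + 1) − L² ≤ 2κ(D₀, s)`. [this work] -/
theorem two_mul_kap_core_add_le (h𝒳 : IsUpperSet (𝒳 : Set (Finset α))) (h𝒵 : IsUpperSet (𝒵 : Set (Finset α))) {D₀ K s : Finset α}
    (l : List α) (hl : l.Nodup) (hls : ∀ y ∈ l, y ∈ s) (hK : K ⊆ s) (hKl : Disjoint K l.toFinset) (hD₀ : Disjoint D₀ s)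
    (htri : ∀ y ∈ l, ∀ s' : Finset α, K ⊆ s' → (#s' : ℤ) + 1 ≤ kap 𝒳 𝒵 (insert y D₀) s') :
    2 * kap 𝒳 𝒵 D₀ K + ((l.length : ℤ) * (2 * #s + 1) - (l.length : ℤ) ^ 2) ≤ 2 * kap 𝒳 𝒵 D₀ s := by
  have h1 := kap_peel_le h𝒳 h𝒵 l s hl hls hD₀
  have h2 := le_two_mul_peelSum_of_core l s hl hls hK hKl htri (𝒳 := 𝒳) (𝒵 := 𝒵) (D := D₀)
  have hKsl : K ⊆ s \ l.toFinset := fun k hk => mem_sdiff.2 ⟨hK hk, fun h => disjoint_left.1 hKl hk h⟩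
  have h3 := kap_le_kap_of_subset h𝒳 h𝒵 (D := D₀) _ K (s \ l.toFinset) rfl hKsl (hD₀.mono_right sdiff_subset)
  linarith

/-- The `e = 3` ("full") points of `T`: `p + y ∈ 𝒳 ∩ 𝒵` for every pair `p ⊆ D`. [this work] -/
def fullPts (𝒳 𝒵 : Finset (Finset α)) (m : α →₀ ℕ) : Finset α :=
  (lev m 1).filter fun y => ∀ p ∈ (dbl m).powersetCard 2, insert y p ∈ 𝒳 ∧ insert y p ∈ 𝒵

/-- Membership in `fullPts`. [this work] -/
theorem mem_fullPts {m : α →₀ ℕ} {y : α} :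
    y ∈ fullPts 𝒳 𝒵 m ↔ y ∈ lev m 1 ∧ ∀ p ∈ (dbl m).powersetCard 2, insert y p ∈ 𝒳 ∧ insert y p ∈ 𝒵 := by
  unfold fullPts; rw [mem_filter]

/-- A full point together with two distinct doubled points is common. [this work] -/
theorem full_pair_mem (m : α →₀ ℕ) {y : α} (hy : y ∈ fullPts 𝒳 𝒵 m) {d x : α} (hd : d ∈ dbl m) (hx : x ∈ dbl m)
    (hdx : d ≠ x) : insert y {d, x} ∈ 𝒳 ∧ insert y {d, x} ∈ 𝒵 :=
  (mem_fullPts.1 hy).2 {d, x} (mem_powersetCard.2 ⟨insert_subset hd (singleton_subset_iff.2 hx), card_pair hdx⟩)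

/-- A full point together with `D ∖ d` is common. [this work] -/
theorem full_erase_mem (m : α →₀ ℕ) (hD : #(dbl m) = 3) {y : α} (hy : y ∈ fullPts 𝒳 𝒵 m) {d : α} (hd : d ∈ dbl m) :
    insert y ((dbl m).erase d) ∈ 𝒳 ∧ insert y ((dbl m).erase d) ∈ 𝒵 :=
  (mem_fullPts.1 hy).2 _ (mem_powersetCard.2 ⟨erase_subset _ _, by rw [card_erase_of_mem hd, hD]⟩)

/-- **The link of a full point contains the triangle `D`**: for `y ∈ fullPts` and any `s' ⊇ D`, `κ({y}, s') ≥ #s' + 1`. [this work] -/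
theorem full_link_triangle (h𝒳 : IsUpperSet (𝒳 : Set (Finset α))) (h𝒵 : IsUpperSet (𝒵 : Set (Finset α)))
    (hX3 : ∀ S ∈ 𝒳, 3 ≤ #S) (hZ3 : ∀ S ∈ 𝒵, 3 ≤ #S) {m : α →₀ ℕ} (hD : #(dbl m) = 3) {y : α} (hy : y ∈ fullPts 𝒳 𝒵 m)
    {s' : Finset α} (hs' : dbl m ⊆ s') : (#s' : ℤ) + 1 ≤ kap 𝒳 𝒵 {y} s' := by
  classical
  obtain ⟨d₁, hd₁⟩ : (dbl m).Nonempty := card_pos.1 (by rw [hD]; norm_num)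
  obtain ⟨d₂, hd₂⟩ : ((dbl m).erase d₁).Nonempty := card_pos.1 (by rw [card_erase_of_mem hd₁, hD]; norm_num)
  obtain ⟨d₃, hd₃⟩ : (((dbl m).erase d₁).erase d₂).Nonempty :=
    card_pos.1 (by rw [card_erase_of_mem hd₂, card_erase_of_mem hd₁, hD]; norm_num)
  have h12 : d₁ ≠ d₂ := (ne_of_mem_erase hd₂).symm
  have h23 : d₂ ≠ d₃ := (ne_of_mem_erase hd₃).symm
  have h13 : d₁ ≠ d₃ := (ne_of_mem_erase (mem_of_mem_erase hd₃)).symm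
  have hd₂D := mem_of_mem_erase hd₂
  have hd₃D := mem_of_mem_erase (mem_of_mem_erase hd₃)
  exact card_add_one_le_kap_single_of_triangle (𝒳 := 𝒳) (𝒵 := 𝒵) h𝒳 h𝒵 hX3 hZ3 (hs' hd₁) (hs' hd₂D) (hs' hd₃D)
    (full_pair_mem m hy hd₁ hd₂D h12) (full_pair_mem m hy hd₂D hd₃D h23) (full_pair_mem m hy hd₁ hd₃D h13) h12 h23 h13

/-! #### The five-point base `D ∪ {a,b}` -/

omit [DecidableEq α] [Fintype α] in
/-- Two finsets differ if some point lies in one but not the other. [folklore] -/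
theorem ne_of_mem_of_notMem' {s t : Finset α} {x : α} (hx : x ∈ t) (hx' : x ∉ s) : s ≠ t := fun h => hx' (h ▸ hx)

omit [Fintype α] in
/-- **Base with `D` common**: `κ(∅, D ∪ {a,b}) ≥ 4` (the sets `D, D+a, D+b, D+a+b`). [this work] -/
theorem four_le_kap_base (h𝒳 : IsUpperSet (𝒳 : Set (Finset α))) (h𝒵 : IsUpperSet (𝒵 : Set (Finset α)))
    (hX3 : ∀ S ∈ 𝒳, 3 ≤ #S) (hZ3 : ∀ S ∈ 𝒵, 3 ≤ #S) {D : Finset α} (hD : #D = 3) {a b : α} (hab : a ≠ b) (haD : a ∉ D)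
    (hbD : b ∉ D) (hDX : D ∈ 𝒳) (hDZ : D ∈ 𝒵) :
    (4 : ℤ) + #(D.filter fun d => insert d {a, b} ∈ 𝒳 ∧ insert d {a, b} ∈ 𝒵) ≤ kap 𝒳 𝒵 ∅ (insert a (insert b D)) := by
  set B := insert a (insert b D)
  set Qd := D.filter fun d => insert d {a, b} ∈ 𝒳 ∧ insert d {a, b} ∈ 𝒵
  have hQinj : Set.InjOn (fun d => insert d ({a, b} : Finset α)) ↑Qd := fun d hd d' hd' h => by
    have hdD : d ∈ D := (mem_filter.1 (Finset.mem_coe.1 hd)).1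
    have hd'D : d' ∈ D := (mem_filter.1 (Finset.mem_coe.1 hd')).1
    have : d ∈ insert d' ({a, b} : Finset α) := by rw [← show insert d ({a,b} : Finset α) = insert d' {a,b} from h]; exact mem_insert_self _ _
    rcases mem_insert.1 this with h' | h'
    · exact h'
    · rcases mem_insert.1 h' with rfl | h''
      · exact absurd hdD haD
      · rw [mem_singleton] at h''; exact absurd (h'' ▸ hdD) hbD
  have hQsub : ∀ U ∈ Qd.image (fun d => insert d ({a, b} : Finset α)), U ⊆ B ∧ U ∈ 𝒳 ∧ U ∈ 𝒵 ∧ #(U ∩ D) = 1 := fun U hU => by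
    obtain ⟨d, hd, rfl⟩ := mem_image.1 hU
    obtain ⟨hdD, hdX, hdZ⟩ := mem_filter.1 hd
    refine ⟨insert_subset (mem_insert_of_mem (mem_insert_of_mem hdD))
      (insert_subset (mem_insert_self _ _) (singleton_subset_iff.2 (mem_insert_of_mem (mem_insert_self _ _)))), hdX, hdZ, ?_⟩
    rw [insert_inter_of_mem hdD, show ({a, b} : Finset α) ∩ D = ∅ from
      disjoint_iff_inter_eq_empty.1 (by rw [disjoint_insert_left, disjoint_singleton_left]; exact ⟨haD, hbD⟩), insert_empty_eq,
      card_singleton]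
  have hB : #B ≤ 5 := by
    rw [card_insert_of_notMem (by simp [hab, haD]), card_insert_of_notMem hbD, hD]
  have hDB : D ⊆ B := (subset_insert _ _).trans (subset_insert _ _)
  set L : Finset (Finset α) := insert D (insert (insert a D) (insert (insert b D) {B}))
  have hL : #L = 4 := by
    have hbaD : b ∉ insert a D := fun h => by
      rcases mem_insert.1 h with h | h
      · exact hab h.symm
      · exact hbD h
    have habD' : a ∉ insert b D := fun h => by
      rcases mem_insert.1 h with h | h
      · exact hab h
      · exact haD h
    have h1 : insert b D ∉ ({B} : Finset (Finset α)) := by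
      rw [mem_singleton]; exact ne_of_mem_of_notMem' (mem_insert_self a _) habD'
    have h2 : insert a D ∉ insert (insert b D) ({B} : Finset (Finset α)) := by
      simp only [mem_insert, mem_singleton, not_or]
      exact ⟨ne_of_mem_of_notMem' (mem_insert_self b D) hbaD, ne_of_mem_of_notMem' (mem_insert_of_mem (mem_insert_self b D)) hbaD⟩
    have h3 : D ∉ insert (insert a D) (insert (insert b D) ({B} : Finset (Finset α))) := by
      simp only [mem_insert, mem_singleton, not_or]
      exact ⟨ne_of_mem_of_notMem' (mem_insert_self a D) haD, ne_of_mem_of_notMem' (mem_insert_self b D) hbD,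
        ne_of_mem_of_notMem' (mem_insert_self a _) haD⟩
    rw [card_insert_of_notMem h3, card_insert_of_notMem h2, card_insert_of_notMem h1, card_singleton]
  have hcommon : ∀ U ∈ L, U ⊆ B ∧ U ∈ 𝒳 ∧ U ∈ 𝒵 := fun U hU => by
    simp only [L, mem_insert, mem_singleton] at hU
    rcases hU with rfl | rfl | rfl | rfl
    · exact ⟨hDB, hDX, hDZ⟩
    · exact ⟨insert_subset (mem_insert_self _ _) hDB, h𝒳 (subset_insert a _) hDX, h𝒵 (subset_insert a _) hDZ⟩
    · exact ⟨insert_subset (mem_insert_of_mem (mem_insert_self _ _)) hDB, h𝒳 (subset_insert b _) hDX, h𝒵 (subset_insert b _) hDZ⟩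
    · exact ⟨Subset.rfl, h𝒳 hDB hDX, h𝒵 hDB hDZ⟩
  have hdisj : Disjoint L (Qd.image fun d => insert d ({a, b} : Finset α)) := disjoint_left.2 fun U hU hU' => by
    have h1 := (hQsub U hU').2.2.2
    have h3 : 3 ≤ #(U ∩ D) := by
      simp only [L, mem_insert, mem_singleton] at hU
      rcases hU with rfl | rfl | rfl | rfl
      · rw [inter_self, hD]
      · rw [insert_inter_of_notMem haD, inter_self, hD]
      · rw [insert_inter_of_notMem hbD, inter_self, hD]
      · rw [show B ∩ D = D from inter_eq_right.2 hDB, hD]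
    omega
  have := card_le_kap_base hX3 hZ3 hB (L := L ∪ Qd.image fun d => insert d ({a, b} : Finset α)) fun U hU => by
    rcases mem_union.1 hU with hU | hU
    · exact hcommon U hU
    · exact ⟨(hQsub U hU).1, (hQsub U hU).2.1, (hQsub U hU).2.2.1⟩
  rw [card_union_of_disjoint hdisj, hL, card_image_of_injOn hQinj] at this; exact_mod_cast this

omit [Fintype α] in
/-- **Base with `D` common and `a, b` full**: `κ(∅, D ∪ {a,b}) ≥ 13` — the sets `P ∪ E` with `P ∈ {D} ∪ binom(D,2)`,
`E ⊆ {a,b}`, `(P,E) ≠ (pair, ∅)`. [this work] -/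
theorem thirteen_le_kap_base (h𝒳 : IsUpperSet (𝒳 : Set (Finset α))) (h𝒵 : IsUpperSet (𝒵 : Set (Finset α)))
    (hX3 : ∀ S ∈ 𝒳, 3 ≤ #S) (hZ3 : ∀ S ∈ 𝒵, 3 ≤ #S) {D : Finset α} (hD : #D = 3) {a b : α} (hab : a ≠ b) (haD : a ∉ D)
    (hbD : b ∉ D) (hDX : D ∈ 𝒳) (hDZ : D ∈ 𝒵) (ha : ∀ d ∈ D, insert a (D.erase d) ∈ 𝒳 ∧ insert a (D.erase d) ∈ 𝒵)
    (hb : ∀ d ∈ D, insert b (D.erase d) ∈ 𝒳 ∧ insert b (D.erase d) ∈ 𝒵) :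
    (13 : ℤ) + #(D.filter fun d => insert d {a, b} ∈ 𝒳 ∧ insert d {a, b} ∈ 𝒵) ≤ kap 𝒳 𝒵 ∅ (insert a (insert b D)) := by
  set B := insert a (insert b D)
  set Qd := D.filter fun d => insert d {a, b} ∈ 𝒳 ∧ insert d {a, b} ∈ 𝒵
  have hQinj : Set.InjOn (fun d => insert d ({a, b} : Finset α)) ↑Qd := fun d hd d' hd' h => by
    have hdD : d ∈ D := (mem_filter.1 (Finset.mem_coe.1 hd)).1
    have : d ∈ insert d' ({a, b} : Finset α) := by rw [← show insert d ({a,b} : Finset α) = insert d' {a,b} from h]; exact mem_insert_self _ _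
    rcases mem_insert.1 this with h' | h'
    · exact h'
    · rcases mem_insert.1 h' with rfl | h''
      · exact absurd hdD haD
      · rw [mem_singleton] at h''; exact absurd (h'' ▸ hdD) hbD
  have hQsub : ∀ U ∈ Qd.image (fun d => insert d ({a, b} : Finset α)), U ⊆ B ∧ U ∈ 𝒳 ∧ U ∈ 𝒵 ∧ #(U ∩ D) = 1 := fun U hU => by
    obtain ⟨d, hd, rfl⟩ := mem_image.1 hU
    obtain ⟨hdD, hdX, hdZ⟩ := mem_filter.1 hd
    refine ⟨insert_subset (mem_insert_of_mem (mem_insert_of_mem hdD))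
      (insert_subset (mem_insert_self _ _) (singleton_subset_iff.2 (mem_insert_of_mem (mem_insert_self _ _)))), hdX, hdZ, ?_⟩
    rw [insert_inter_of_mem hdD, show ({a, b} : Finset α) ∩ D = ∅ from
      disjoint_iff_inter_eq_empty.1 (by rw [disjoint_insert_left, disjoint_singleton_left]; exact ⟨haD, hbD⟩), insert_empty_eq,
      card_singleton]
  have hB : #B ≤ 5 := by
    rw [card_insert_of_notMem (by simp [hab, haD]), card_insert_of_notMem hbD, hD]
  have hDB : D ⊆ B := (subset_insert _ _).trans (subset_insert _ _)
  have haB : a ∈ B := mem_insert_self _ _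
  have hbB : b ∈ B := mem_insert_of_mem (mem_insert_self _ _)
  -- the parts
  set DP : Finset (Finset α) := insert D (D.powersetCard 2)
  set E3 : Finset (Finset α) := insert {a} (insert {b} {{a, b}})
  have hDP : #DP = 4 := by
    rw [card_insert_of_notMem (fun h => by have := (mem_powersetCard.1 h).2; omega), card_powersetCard, hD]; rfl
  have hE3 : #E3 = 3 := by
    have h1 : ({b} : Finset α) ∉ ({{a, b}} : Finset (Finset α)) := by
      rw [mem_singleton]; exact ne_of_mem_of_notMem' (mem_insert_self a _) (by simp [hab])
    have h2 : ({a} : Finset α) ∉ insert {b} ({{a, b}} : Finset (Finset α)) := by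
      simp only [mem_insert, mem_singleton, not_or]
      exact ⟨fun h => hab (by rw [← mem_singleton, ← h]; exact mem_singleton_self a),
        ne_of_mem_of_notMem' (mem_insert_of_mem (mem_singleton_self b)) (by simp [hab.symm])⟩
    rw [card_insert_of_notMem h2, card_insert_of_notMem h1, card_singleton]
  set Dom := DP ×ˢ E3 ∪ {(D, (∅ : Finset α))}
  have hDom : #Dom = 13 := by
    rw [card_union_of_disjoint (disjoint_singleton_right.2 fun h => by
      have h2 := (mem_product.1 h).2
      simp only [E3, mem_insert, mem_singleton] at h2
      rcases h2 with h2 | h2 | h2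
      · exact singleton_ne_empty a h2.symm
      · exact singleton_ne_empty b h2.symm
      · exact insert_ne_empty a {b} h2.symm), card_product, hDP, hE3, card_singleton]
  have hparts : ∀ q ∈ Dom, q.1 ⊆ D ∧ q.2 ⊆ {a, b} ∧ (q.1 = D ∨ (#q.1 = 2 ∧ q.2.Nonempty)) := fun q hq => by
    rcases mem_union.1 hq with hq | hq
    · obtain ⟨h1, h2⟩ := mem_product.1 hq
      have hE : q.2 ⊆ {a, b} ∧ q.2.Nonempty := by
        simp only [E3, mem_insert, mem_singleton] at h2
        rcases h2 with h | h | h <;> rw [h]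
        · exact ⟨singleton_subset_iff.2 (mem_insert_self _ _), singleton_nonempty _⟩
        · exact ⟨singleton_subset_iff.2 (mem_insert_of_mem (mem_singleton_self _)), singleton_nonempty _⟩
        · exact ⟨Subset.rfl, insert_nonempty _ _⟩
      rcases mem_insert.1 h1 with h | h
      · exact ⟨h ▸ Subset.rfl, hE.1, Or.inl h⟩
      · exact ⟨(mem_powersetCard.1 h).1, hE.1, Or.inr ⟨(mem_powersetCard.1 h).2, hE.2⟩⟩
    · rw [mem_singleton] at hq; rw [hq]; exact ⟨Subset.rfl, empty_subset _, Or.inl rfl⟩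
  have habD : Disjoint ({a, b} : Finset α) D := by
    rw [disjoint_insert_left, disjoint_singleton_left]; exact ⟨haD, hbD⟩
  have hinj : Set.InjOn (fun q : Finset α × Finset α => q.1 ∪ q.2) ↑Dom := by
    intro q hq q' hq' h
    obtain ⟨h1, h2, -⟩ := hparts q (Finset.mem_coe.1 hq)
    obtain ⟨h1', h2', -⟩ := hparts q' (Finset.mem_coe.1 hq')
    have e : q.1 ∪ q.2 = q'.1 ∪ q'.2 := h
    have hd1 : Disjoint q.2 D := habD.mono_left h2
    have hd1' : Disjoint q'.2 D := habD.mono_left h2'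
    have eP : q.1 = q'.1 := by
      have := congrArg (fun U => U ∩ D) e
      simp only [union_inter_distrib_right, inter_eq_left.2 h1, inter_eq_left.2 h1', disjoint_iff_inter_eq_empty.1 hd1,
        disjoint_iff_inter_eq_empty.1 hd1', union_empty] at this
      exact this
    have eE : q.2 = q'.2 := by
      have := congrArg (fun U => U \ D) e
      simp only [union_sdiff_distrib, sdiff_eq_empty_iff_subset.2 h1, sdiff_eq_empty_iff_subset.2 h1', empty_union,
        sdiff_eq_self_of_disjoint hd1, sdiff_eq_self_of_disjoint hd1'] at this
      exact this
    exact Prod.ext eP eE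
  set L := Dom.image fun q : Finset α × Finset α => q.1 ∪ q.2
  have hL : #L = 13 := by rw [card_image_of_injOn hinj, hDom]
  have hcommon : ∀ U ∈ L, U ⊆ B ∧ U ∈ 𝒳 ∧ U ∈ 𝒵 := fun U hU => by
    obtain ⟨q, hq, rfl⟩ := mem_image.1 hU
    obtain ⟨h1, h2, h3⟩ := hparts q hq
    have hsub : q.1 ∪ q.2 ⊆ B := union_subset (h1.trans hDB) (h2.trans (insert_subset haB (singleton_subset_iff.2 hbB)))
    refine ⟨hsub, ?_⟩
    rcases h3 with h3 | ⟨hc, hne⟩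
    · exact ⟨h𝒳 (h3 ▸ subset_union_left) hDX, h𝒵 (h3 ▸ subset_union_left) hDZ⟩
    · -- q.1 = D.erase d for the point d of D ∖ q.1
      have hsd : #(D \ q.1) = 1 := by rw [card_sdiff_of_subset h1, hD, hc]
      obtain ⟨d, hd⟩ := card_eq_one.1 hsd
      have hdD : d ∈ D := (mem_sdiff.1 (by rw [hd]; exact mem_singleton_self d)).1
      have hP : D.erase d = q.1 := by rw [erase_eq, ← hd, Finset.sdiff_sdiff_eq_self h1]
      obtain ⟨e, he⟩ := hne
      have he' : e = a ∨ e = b := by simpa using h2 he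
      have key : insert e (D.erase d) ⊆ q.1 ∪ q.2 := by
        rw [hP]; exact insert_subset (mem_union_right _ he) subset_union_left
      rcases he' with rfl | rfl
      · exact ⟨h𝒳 key (ha d hdD).1, h𝒵 key (ha d hdD).2⟩
      · exact ⟨h𝒳 key (hb d hdD).1, h𝒵 key (hb d hdD).2⟩
  have hdisj : Disjoint L (Qd.image fun d => insert d ({a, b} : Finset α)) := disjoint_left.2 fun U hU hU' => by
    have h1 := (hQsub U hU').2.2.2
    obtain ⟨q, hq, rfl⟩ := mem_image.1 hU
    obtain ⟨hq1, hq2, hq3⟩ := hparts q hq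
    have h2 : 2 ≤ #((q.1 ∪ q.2) ∩ D) := by
      rw [union_inter_distrib_right, inter_eq_left.2 hq1, disjoint_iff_inter_eq_empty.1 (habD.mono_left hq2), union_empty]
      rcases hq3 with h | ⟨h, _⟩
      · rw [h, hD]; norm_num
      · rw [h]
    omega
  have := card_le_kap_base hX3 hZ3 hB (L := L ∪ Qd.image fun d => insert d ({a, b} : Finset α)) fun U hU => by
    rcases mem_union.1 hU with hU | hU
    · exact hcommon U hU
    · exact ⟨(hQsub U hU).1, (hQsub U hU).2.1, (hQsub U hU).2.2.1⟩
  rw [card_union_of_disjoint hdisj, hL, card_image_of_injOn hQinj] at this; exact_mod_cast this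

end RowThreeChain

end Summit.CriticalPhenomena.PercolationContinuityZ3.Theorems.SahiCTCForms
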